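import Summits.BirchSwinnertonDyer.Rank1Residual.Partition.CornersGreenbergMu
import Summits.BirchSwinnertonDyer.Rank1Residual.X11b.ClassClosureDisegniLever
import Literature.NumberTheory.EllipticCurves.Disegni2020.PAdicBSDRankOneMultiplicative
import HarnessLib

/-!
# The MULTIPLICATIVE axis in rank `≤ 1`: modulo the pair's Schneider certificate the §C corner is
# X11a ∨ X2 ∨ (X11b off the `p`-adic lever's locus) — the rank-one irreducible class X11b SHRINKS to
# its ¬(ram) part (and the split pairs at `p = 3`) (cell `b2b-bsdres`, RESIDUAL-MAP.md §C rows
# '(ram) × r = 1', 'X11b p ≥ 5', 'X11b @ 3' = §I N8 / O2; CLASS-CLOSURE lane E2 for N8/O2; rmap-1 gen 8)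

HONEST FRAMING (run/shared/lean/b2b/bsd-rank1-residual/, verbatim in every file): the goal of the
cell is to DELETE the COMBINATION-SHAPED residual classes of the Birch–Swinnerton-Dyer formula for
ALL analytic-rank `≤ 1` elliptic curves over `ℚ` — "full BSD formula for every rank `≤ 1` curve in
class `C`" assembled STRICTLY from published theorems — so that the rank-`≤ 1` remainder becomes
exactly the CONSTRUCTION-SHAPED classes, which are TYPED (missing-input `Prop`s), NOT attempted.
This is not "finishing BSD". Theorems only; NO definition, NO named fact introduced here; every
published theorem enters as one of the tree's existing named Literature facts BY NAME; nothing
about any particular curve is asserted; no label changes; nothing is booked by this file; X11b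
stays CONSTRUCTION-SHAPED until the referee says otherwise.

## What this file records

`Partition/Corners.lean` (rmap-1 gen 2) closes the multiplicative axis in rank `0` outside the
corners X11a ('(ram) fails') and X2 (`E[p]` reducible) by Skinner 2016 Thm. C; in rank `1` the whole
irreducible class X11b (`p ‖ N`, `r = 1`, `E[p]` irreducible) was a corner ('STEP L', §I N8 / O2).
The CLASS-CLOSURE typer cc-typer-3's `X11b/ClassClosureDisegniLever.lean` (p249340) supplies, on the
(ram) locus of X11b, the rank-one comparison by the CYCLOTOMIC road from three PUBLISHED named facts:
Skinner, Pacific J. Math. 283 (2016) Thm. A (main conjecture EQUALITY at `p ‖ N`, `p ≥ 3`,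
(irr) + (ram); `Skinner2016.thmA_charIdeal_multiplicative`), Stein–Wuthrich, Math. Comp. 82 (2013)
Thm. 6.1 (Jones's algebraic leading term at a multiplicative `p ≠ 2`;
`SteinWuthrich2013.thm61_{nonsplit,split}Multiplicative` with the §4.2 height existence
`exists_isMultCanonical` / `exists_isSplitMultCanonical`) and Disegni, Kyoto J. Math. 60 (2020)
Thm. 1 = Thm. 4 (the relative `p`-adic BSD leading term in analytic rank one;
`Disegni2020.thm1_padicBSD_rankOne_multiplicative`, registry A183 in `CITED-FACTS.md` — the
register of record per referee R133.0, which re-maps R132's label 'A180'; non-split clause ANY odd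
`p`, split clause `p ≥ 5` + a second multiplicative prime — which (ram) supplies), MODULO ONE per-pair
input: Schneider's non-degeneracy of THE canonical `p`-adic height (`SchneiderConjecture Dh` for the
§4.2 datum). This file lifts that to the Partition level, the shape of RESIDUAL-MAP §C's corner
predicate:

* `bsdp_of_classX11b_of_ram_of_schneider` — X11b ∧ Ram ∧ (split → `p ≥ 5`) ∧ the certificate ⇒
  `BSD(E,p)`: the two lever theorems with Disegni's clause fed from the NAMED fact (seven named
  facts + two certificate binders, one per reduction sub-type);
* `bsdp_mult_of_schneider_sharp` — **odd multiplicative `p`, `r ≤ 1`, the pair's Schneider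
  certificate: `BSD(E,p)` unless X11a, or X2, or X11b OFF the lever's locus
  (`¬Ram`, or split at `p = 3`)** — TEN named facts (Skinner Thm. C for rank `0`; Skinner Thm. A,
  SW 6.1 ×2, §4.2 existence ×2, Disegni Thm. 1 for rank `1`; modularity ×2, GZK); partition form
  `bsdp_or_corner_mult_of_schneider`;
* `bsdp_goodOrd_or_mult_of_five_le_rankLeOne_of_certificates` — the coordinator's domain at `p ≥ 5`
  WIDENED to 'good ordinary, or multiplicative' in BOTH ranks: granted the pair's Schneider
  certificate (good-ordinary and multiplicative shapes) and, on X9, Greenberg's `μ = 0` + the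
  unit-coefficient certificate (`CornersGreenbergMu`), `BSD(E,p)` holds unless
  `(X1 ∧ ¬gvpar) ∨ X11a ∨ X2 ∨ (X11b ∧ ¬Ram)` — nineteen named facts.

Census of record for the locus (cc-typer-3 on rmap-3 g5's `x11b3left` / `x11b5left`, RESIDUAL-MAP §C
RMAP NOTE (rmap-1 g8) 'p-ADIC LEVER', cross-checked by rmap-3 gen 6's join
`b2b-bsdres-rmap-3/g6/x11b3lever/lever_join.tsv`): O2 = X11b at `3` — of the 1 684 true-open classes
722 are non-split ∧ (ram) (on the locus), 961 split ∧ (ram) (off: Disegni's (∗) reads `p ≥ 5`), and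
1 is non-split WITHOUT a (ram) witness (318828a1, `N = 2²·3·163²`; off); N8 = X11b at `p ≥ 5` —
3 723 of 3 861 cells (ram) (on the locus), 138 ¬(ram) (off: Skinner's Thm. A needs (ram)).
The binders `hSchN` / `hSchS` are PER PAIR — OPEN hypotheses at the pair, so by referee ruling
R133.2 (2026-08-21T06:00Z) the sub-cell `X11b ∧ Ram ∧ (¬Split ∨ 5 ≤ p)` is "COMBINATION,
certificate-shaped — covered MODULO per-pair Schneider certificates in the R17.3 / §I N1′ wording,
NOT covered-from-print": no RESIDUAL-MAP mark moves from open to covered. Flags that ride: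
`Dis20-Thm1-split-Venerucci-irred` on the split clause (X11b is irreducible by definition — harmless);
`Dis20-height-identification-reading` (R133.2 (ii): Disegni's `p`-adic height is Nekovář's =
Schneider's / Mazur–Tate's at an ordinary `p` — Disegni, Compositio Math. 153 (2017), p. 7 — a READING
flag that travels with every consumer of A183 until that page cite sits in the fact's docstring);
Skinner Thm. A / C and SW 6.1 flag-free; the good-ordinary flags as in `CornersGreenbergMu`.

References: RESIDUAL-MAP.md §C (rows '(ram)', 'X11b p ≥ 5', 'X11b @ 3'; RMAP NOTE (rmap-1 g8)
'THE CYCLOTOMIC p-ADIC LEVER'), §I N8 / O2; `X11b/ClassClosureDisegniLever.lean` (cc-typer-3);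
`Partition/Corners.lean`, `Partition/CornersGreenbergMu.lean`; [Skinner2016PacificMC] Thm. A, Thm. C;
[SteinWuthrich2013] Thm. 6.1, §4.2; [Disegni2020] Thm. 1 (§1.2), Thm. 4 (§3.2); [Miller2011LMS]
Def. 1.1.
-/

namespace Summit.BirchSwinnertonDyer.Rank1Residual

open WeierstrassCurve Literature.NumberTheory.EllipticCurves
  Literature.NumberTheory.EllipticCurves.Rank1Residual Literature.NumberTheory.EllipticCurves.ModularForms
  Literature.NumberTheory.EllipticCurves.Wuthrich2014
  Literature.NumberTheory.EllipticCurves.Rank1Residual.Typed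
  Literature.NumberTheory.EllipticCurves.Skinner2016
  Literature.NumberTheory.EllipticCurves.SteinWuthrich2013
  Literature.NumberTheory.EllipticCurves.Disegni2020
open scoped NumberField ModularForm

section Curve

variable {W : WeierstrassCurve ℚ} [W.IsElliptic] [W.IsGloballyMinimal] {p : ℕ} [Fact p.Prime]

/-! ### The X11b exit on the lever's locus -/

/-- **X11b ∧ Ram ∧ (split → `p ≥ 5`) ∧ Schneider certificate ⇒ `BSD(E,p)`** — cc-typer-3's two lever
theorems (`X11b.bsdp_of_ram_nonsplit_of_schneider`, any odd `p`; `…_of_ram_split_of_five_le_of_schneider`)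
with Disegni's Thm. 1 fed from the NAMED fact (`hD`) instead of the inline clause. Named facts:
Skinner 2016 Thm. A (`hA`), Stein–Wuthrich 2013 Thm. 6.1 non-split / split (`hJn`, `hJs`), §4.2
height existence (`hHn`, `hHs`), Disegni 2020 Thm. 1 (`hD`), GZK (`hGZK`), modularity (`hpar`);
per-pair certificate binders `hSchN` (THE §4.2 datum at a non-split `p`) / `hSchS` (the modified §4.2
datum at a split `p`). [cite: Skinner2016PacificMC, Thm. A (§1)] [cite: SteinWuthrich2013, Thm. 6.1, §4.2]
[cite: Disegni2020, Thm. 1 (§1.2) and Thm. 4 (§3.2)] -/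
theorem bsdp_of_classX11b_of_ram_of_schneider (hA : thmA_charIdeal_multiplicative)
    (hJn : thm61_nonsplitMultiplicative) (hJs : thm61_splitMultiplicative)
    (hHn : exists_isMultCanonical) (hHs : exists_isSplitMultCanonical)
    (hD : thm1_padicBSD_rankOne_multiplicative)
    (hGZK : rank_eq_analyticRank_of_analyticRank_le_one) (hpar : nonempty_modularParametrizationData)
    (hX : ClassX11b W p) (hram : Ram W p)
    (h5 : W.HasSplitMultiplicativeReductionAtPrime p → 5 ≤ p)
    (hSchN : ∀ (q : ℚ_[p]) (Dh : PAdicHeightData W p), q ≠ 0 → ‖q‖ < 1 → tateJ q = (W.j : ℚ_[p]) →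
      IsMultCanonical Dh q → SchneiderConjecture Dh)
    (hSchS : ∀ (Dq : TateParameterData W p) (Dh : PAdicHeightData W p),
      IsSplitMultCanonical Dh Dq → SchneiderConjecture Dh) : BSDp W p := by
  by_cases hsplit : W.HasSplitMultiplicativeReductionAtPrime p
  · exact X11b.bsdp_of_ram_split_of_five_le_of_schneider W p hA hJs hHs hGZK hpar
      (fun hf ϖ hϖ0 hϖ hp5 hm Dq L hL Dh hDh =>
        thm1_padicBSD_rankOne_multiplicative.split hD W p hX.2.1 hX.2.2.1 hX.1 hf ϖ hϖ0 hϖ hsplit hp5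
          hm Dq L hL Dh hDh)
      hX hsplit hram (h5 hsplit) hSchS
  · exact X11b.bsdp_of_ram_nonsplit_of_schneider W p hA hJn hHn hGZK hpar
      (fun hf ϖ hϖ0 hϖ q hq0 hq1 hqj L hL Dh hDh =>
        thm1_padicBSD_rankOne_multiplicative.nonsplit hD W p hX.2.1 hX.2.2.1 hX.1 hf ϖ hϖ0 hϖ hsplit
          hq0 hq1 hqj L hL Dh hDh)
      hX hsplit hram hSchN

/-! ### The §C headline in rank `≤ 1`, corner sharpened modulo the certificate -/

/-- **SHARP MODULO THE SCHNEIDER CERTIFICATE, multiplicative axis, rank `≤ 1`: TEN named facts.**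
For every `E/ℚ` (globally minimal `W`) of analytic rank `≤ 1` and every ODD prime `p` of
MULTIPLICATIVE reduction carrying the pair's Schneider certificate (`hSchN` / `hSchS`, idle in rank
`0`), `BSD(E,p)` holds unless `(E, p)` lies in X11a (`r = 0`, irreducible, no (ram) witness), in X2
(`E[p]` reducible), or in X11b OFF the `p`-adic lever's locus (`r = 1`, irreducible, and: no (ram)
witness, or split at `p = 3`). Rank `0`: Skinner 2016 Thm. C (`hSk`; `Corners.bsdp_mult_rankZero_of_
not_corner`); rank `1`: `bsdp_of_classX11b_of_ram_of_schneider`. RESIDUAL-MAP §C / §I N8–O2 in kernel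
form. [folklore] -/
theorem bsdp_mult_of_schneider_sharp (hSk : Skinner2016.thmC_padicValRat_bsd_rank_zero)
    (hmod : hasEntireLFunction_rat) (hGZK : rank_eq_analyticRank_of_analyticRank_le_one)
    (hA : thmA_charIdeal_multiplicative)
    (hJn : thm61_nonsplitMultiplicative) (hJs : thm61_splitMultiplicative)
    (hHn : exists_isMultCanonical) (hHs : exists_isSplitMultCanonical)
    (hD : thm1_padicBSD_rankOne_multiplicative) (hpar : nonempty_modularParametrizationData)
    (hp : p ≠ 2) (hm : Mult W p) (hr : W.analyticRank ≤ 1)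
    (hSchN : ∀ (q : ℚ_[p]) (Dh : PAdicHeightData W p), q ≠ 0 → ‖q‖ < 1 → tateJ q = (W.j : ℚ_[p]) →
      IsMultCanonical Dh q → SchneiderConjecture Dh)
    (hSchS : ∀ (Dq : TateParameterData W p) (Dh : PAdicHeightData W p),
      IsSplitMultCanonical Dh Dq → SchneiderConjecture Dh)
    (hX11a : ¬ ClassX11a W p) (hX2 : ¬ ClassX2 W p)
    (hlev : ¬ (ClassX11b W p ∧ ¬ (Ram W p ∧ (W.HasSplitMultiplicativeReductionAtPrime p → 5 ≤ p)))) :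
    BSDp W p := by
  rcases Nat.le_one_iff_eq_zero_or_eq_one.mp hr with hr0 | hr1
  · exact bsdp_mult_rankZero_of_not_corner hSk hmod hGZK hp hm hr0 hX11a hX2
  · by_cases hirr : Irr W p
    · have hX : ClassX11b W p := ⟨hr1, hp, hm, hirr⟩
      have hloc : Ram W p ∧ (W.HasSplitMultiplicativeReductionAtPrime p → 5 ≤ p) := by
        by_contra hnot
        exact hlev ⟨hX, hnot⟩
      exact bsdp_of_classX11b_of_ram_of_schneider hA hJn hJs hHn hHs hD hGZK hpar hX hloc.1 hloc.2
        hSchN hSchS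
    · exact absurd ⟨hp, hirr, hm⟩ hX2

/-- **Partition form on the multiplicative axis, rank `≤ 1`, modulo the certificate:
`BSD(E,p) ∨ X11a ∨ X2 ∨ (X11b off the lever's locus)`** from the same ten named facts. [folklore] -/
theorem bsdp_or_corner_mult_of_schneider (hSk : Skinner2016.thmC_padicValRat_bsd_rank_zero)
    (hmod : hasEntireLFunction_rat) (hGZK : rank_eq_analyticRank_of_analyticRank_le_one)
    (hA : thmA_charIdeal_multiplicative)
    (hJn : thm61_nonsplitMultiplicative) (hJs : thm61_splitMultiplicative)
    (hHn : exists_isMultCanonical) (hHs : exists_isSplitMultCanonical)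
    (hD : thm1_padicBSD_rankOne_multiplicative) (hpar : nonempty_modularParametrizationData)
    (hp : p ≠ 2) (hm : Mult W p) (hr : W.analyticRank ≤ 1)
    (hSchN : ∀ (q : ℚ_[p]) (Dh : PAdicHeightData W p), q ≠ 0 → ‖q‖ < 1 → tateJ q = (W.j : ℚ_[p]) →
      IsMultCanonical Dh q → SchneiderConjecture Dh)
    (hSchS : ∀ (Dq : TateParameterData W p) (Dh : PAdicHeightData W p),
      IsSplitMultCanonical Dh Dq → SchneiderConjecture Dh) :
    BSDp W p ∨ ClassX11a W p ∨ ClassX2 W p ∨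
      (ClassX11b W p ∧ ¬ (Ram W p ∧ (W.HasSplitMultiplicativeReductionAtPrime p → 5 ≤ p))) := by
  by_cases hX11a : ClassX11a W p
  · exact Or.inr (Or.inl hX11a)
  · by_cases hX2 : ClassX2 W p
    · exact Or.inr (Or.inr (Or.inl hX2))
    · by_cases hlev : ClassX11b W p ∧ ¬ (Ram W p ∧ (W.HasSplitMultiplicativeReductionAtPrime p → 5 ≤ p))
      · exact Or.inr (Or.inr (Or.inr hlev))
      · exact Or.inl (bsdp_mult_of_schneider_sharp hSk hmod hGZK hA hJn hJs hHn hHs hD hpar hp hm hr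
          hSchN hSchS hX11a hX2 hlev)

/-! ### The coordinator's domain at `p ≥ 5` WIDENED to both ranks on the multiplicative axis -/

/-- **Non-CM, `p ≥ 5`, 'good ORDINARY, or MULTIPLICATIVE', analytic rank `≤ 1` (BOTH ranks on both
axes): NINETEEN named facts.** Granted the pair's Schneider certificate in the shape its reduction
type asks (`hSch` good ordinary, `hSchN` non-split, `hSchS` split) and, only on X9, Greenberg's `μ = 0`
at the pair + one unit coefficient of `𝓛_p(E)` (`hμ`, `hcert`), `BSD(E,p)` holds unless `(E, p)` lies
in the Keller–Yin locus `X1 ∧ ¬gvpar` (good ordinary axis), in X11a or X2 (multiplicative axis), or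
in X11b WITHOUT a (ram) witness (at `p ≥ 5` the split condition of the lever is automatic). Composes
`CornersGreenbergMu.bsdp_goodOrd_of_five_le_of_schneider_of_greenbergMu` with
`bsdp_mult_of_schneider_sharp`. [folklore] -/
theorem bsdp_goodOrd_or_mult_of_five_le_rankLeOne_of_certificates
    (hBCS : BurungaleCastellaSkinner2025.cor131_padicValRat_bsd_rank_le_one)
    (hBCSa : burungale_castella_skinner_charIdeal_eq_padicLFunction)
    (hGZK : rank_eq_analyticRank_of_analyticRank_le_one)
    (hCGS : CastellaGrossiSkinner2025.thmD_padicValRat_bsd_rank_le_one)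
    (hGV : GreenbergVatsal2000.thm13_charIdeal_eq_of_gvPar) (hGr : greenberg_charValue_rankZero)
    (hmod : hasEntireLFunction_rat) (hmodP : nonempty_modularParametrizationData)
    (hS : Schneider1985_order_charGenerator) (hPR : perrinRiou_rankOne_leadingTerms)
    (hΩ : realPeriodRat_eq_unit_mul_plusPeriod)
    (hSk : Skinner2016.thmC_padicValRat_bsd_rank_zero) (hA : thmA_charIdeal_multiplicative)
    (hJn : thm61_nonsplitMultiplicative) (hJs : thm61_splitMultiplicative)
    (hHn : exists_isMultCanonical) (hHs : exists_isSplitMultCanonical)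
    (hD : thm1_padicBSD_rankOne_multiplicative)
    (hcm : ¬ W.HasCM) (hr : W.analyticRank ≤ 1) (h5 : 5 ≤ p) (hdom : GoodOrd W p ∨ Mult W p)
    (hSch : ∀ Dh : PAdicHeightData W p, Dh.IsCanonical → SchneiderConjecture Dh)
    (hSchN : ∀ (q : ℚ_[p]) (Dh : PAdicHeightData W p), q ≠ 0 → ‖q‖ < 1 → tateJ q = (W.j : ℚ_[p]) →
      IsMultCanonical Dh q → SchneiderConjecture Dh)
    (hSchS : ∀ (Dq : TateParameterData W p) (Dh : PAdicHeightData W p),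
      IsSplitMultCanonical Dh Dq → SchneiderConjecture Dh)
    (hμ : ClassX9 W p → ∀ (κ : ZpExtension ℚ p) (γ : Field.absoluteGaloisGroup ℚ),
        κ.IsCyclotomic → κ.IsTopGenerator γ → IsCyclotomicVariable p γ →
      ∀ (D : W.SelmerDualData κ γ), D.mu = 0)
    (hcert : ClassX9 W p → ∀ [NeZero (W.conductorNorm ℤ)]
        (f : CuspForm (CongruenceSubgroup.Gamma0 (W.conductorNorm ℤ)) 2),
        IsNewformOf W f → ∀ (ϖ : ℚ), (ϖ : ℝ) * W.realPeriodRat = plusPeriod f →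
      ∃ n : ℕ, ‖PowerSeries.coeff n
        (PowerSeries.C (ϖ : ℚ_[p]) * padicLFunction f (unitRoot W p : ℚ_[p]))‖ = 1)
    (hA1 : ¬ (ClassX1 W p ∧ ¬ GVPar W p)) (hX11a : ¬ ClassX11a W p) (hX2 : ¬ ClassX2 W p)
    (hX11b : ¬ (ClassX11b W p ∧ ¬ Ram W p)) : BSDp W p := by
  rcases hdom with hgo | hm
  · exact bsdp_goodOrd_of_five_le_of_schneider_of_greenbergMu hBCS hBCSa hGZK hCGS hGV hGr hmod hmodP
      hS hPR hΩ hcm hr hgo h5 hSch hμ hcert hA1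
  · refine bsdp_mult_of_schneider_sharp hSk hmod hGZK hA hJn hJs hHn hHs hD hmodP (by omega) hm hr
      hSchN hSchS hX11a hX2 ?_
    rintro ⟨hX, hnot⟩
    by_cases hram : Ram W p
    · exact hnot ⟨hram, fun _ => h5⟩
    · exact hX11b ⟨hX, hram⟩

end Curve

end Summit.BirchSwinnertonDyer.Rank1Residual
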